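import Literature.MathematicalPhysics.QuantumLattice.GermMarkovSpectralCriterionSplitting
import Literature.MathematicalPhysics.QuantumLattice.SchwartzReIm
import Literature.Analysis.Distribution.FourierSupportAtZeroPolynomial
import HarnessLib

/-!
# Rozanov's spectral criterion, proof part II: the spectral side (duality)

Topic `MathematicalPhysics/QuantumLattice`; second proof file for the named fact
`InvSpectralDensityPolynomialOfCollarMarkov` (file `GermMarkovSpectralCriterion`; Yu. A. Rozanov,
*Markov Random Fields* (1982), Ch. 3 §1.2–§1.4 and §2.3, necessity half).  THEOREM-ONLY file.

Fix a centred Gaussian law `μ` on `𝓢'(V)` with covariance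
`E[X_u X_v] = Re ∫ φ(ξ) û(ξ) conj(v̂(ξ)) dξ` for a measurable, even, a.e. positive, temperate
spectral density `φ` with temperate inverse `φ⁻¹`.  Following Rozanov (Ch. 3 §1.2, (1.13)–(1.17))
we realise the Gaussian space `H(V) ⊆ L²(μ)` inside the spectral space `L²(ν)`,
`ν = φ dξ` (`X_w ↦ ŵ`, an isometry by the covariance hypothesis,
`inner_toLp_eval_eq_re_inner`), and construct for every real test function `u` the **dual
element** `x_u ∈ H(V)` (Rozanov's `ξ*_u`, Ch. 3 §1.3 (1.22)–(1.25)): the image of `û / φ ∈ L²(ν)`,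
characterised by `⟪x_u, X_w⟫ = ∫ u w` (`exists_dual_element`), with
`⟪x_u, x_v⟫ = Re ∫ φ⁻¹ conj(û) v̂` (the dual field has spectral density `φ⁻¹`, Rozanov (1.25)).
Since `⟪x_u, X_w⟫ = 0` whenever `supp u ∩ supp w = ∅`, the dual element of `u` supported in the
closed ball `B̄(0, r - ε)` is orthogonal to `H((∂B(0,r))^ε)` and to `H(B̄(0,r)ᶜ)`, and the dual
element of `v` supported off `B(0, r + ε)` is orthogonal to `H((∂B(0,r))^ε)` and to `H(B(0,r))`;
the splitting `inner_eq_zero_of_collar_condIndepCondExp` of part I (Rozanov Ch. 2 §3.3 (3.10),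
Ch. 3 §2.3) then gives the key identity of the necessity proof
(`re_integral_inv_mul_conj_fourier_mul_fourier_eq_zero`):

  `Re ∫ φ(ξ)⁻¹ conj(û(ξ)) v̂(ξ) dξ = 0` whenever `supp u ⊆ B̄(0, r-ε)`, `supp v ⊆ B(0, r+ε)ᶜ`

and the collar `(∂B(0,r))^ε` splits `B(0,r)` from `B̄(0,r)ᶜ`.  Part III
(`GermMarkovSpectralCriterionProofs`) lets `u` run through an approximate identity and concludes
with the Fourier-support-at-zero theorem.

## References

* Yu. A. Rozanov, *Markov Random Fields*, Springer (1982), Ch. 3 §1.2 (1.13)–(1.17), §1.3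
  (1.22)–(1.25), §2.3 Theorem (necessity). [Rozanov1982]

## Mathlib / tree

`Measure.withDensity`, `integral_withDensity_eq_integral_toReal_smul`,
`integrable_withDensity_iff_integrable_smul'`, `Measure.HasTemperateGrowth`, `SchwartzMap.toLp`,
`SchwartzMap.denseRange_toLpCLM`, `SchwartzMap.inner_toL2_toL2_eq`,
`SchwartzMap.integral_inner_fourier_fourier` (Plancherel), `MeasureTheory.L2.inner_def`,
`integral_neg_eq_self`, `cauchySeq_tendsto_of_complete`; the tree's `gaussianSpan`,
`ofRealTest`, `reTest` / `imTest`, and part I.  No new definitions.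
-/

noncomputable section

open MeasureTheory ProbabilityTheory Filter Metric Set Complex FourierTransform
open scoped Topology InnerProductSpace ENNReal SchwartzMap ComplexConjugate
open Literature.Probability.Distributions Literature.Analysis.Distribution

namespace Literature.MathematicalPhysics.QuantumLattice

/-! ### The spectral measure `ν = φ dξ` -/

section DensityGeneral

variable {α : Type*} [MeasurableSpace α] {μ₀ : Measure α} {φ : α → ℝ}

/-- Integration against the measure `φ dμ₀` is integration of `φ · g` (no integrability
needed: both sides vanish together). [folklore] -/
theorem integral_withDensity_ofReal_eq (hφm : Measurable φ) (hφ0 : ∀ ξ, 0 ≤ φ ξ) (g : α → ℂ) :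
    ∫ ξ, g ξ ∂(μ₀.withDensity fun ξ => ENNReal.ofReal (φ ξ)) = ∫ ξ, (φ ξ : ℂ) * g ξ ∂μ₀ := by
  rw [integral_withDensity_eq_integral_toReal_smul hφm.ennreal_ofReal
    (Eventually.of_forall fun _ => ENNReal.ofReal_lt_top)]
  refine integral_congr_ae (Eventually.of_forall fun ξ => ?_)
  simp only [ENNReal.toReal_ofReal (hφ0 ξ), Complex.real_smul]

/-- Integrability against `φ dμ₀` is integrability of `φ • g`. [folklore] -/
theorem integrable_withDensity_ofReal_iff (hφm : Measurable φ) (hφ0 : ∀ ξ, 0 ≤ φ ξ)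
    {E' : Type*} [NormedAddCommGroup E'] [NormedSpace ℝ E'] {g : α → E'} :
    Integrable g (μ₀.withDensity fun ξ => ENNReal.ofReal (φ ξ)) ↔
      Integrable (fun ξ => φ ξ • g ξ) μ₀ := by
  rw [integrable_withDensity_iff_integrable_smul' hφm.ennreal_ofReal
    (Eventually.of_forall fun _ => ENNReal.ofReal_lt_top)]
  simp_rw [ENNReal.toReal_ofReal (hφ0 _)]

end DensityGeneral

variable {V : Type*} [NormedAddCommGroup V] [InnerProductSpace ℝ V] [FiniteDimensional ℝ V]
  [MeasurableSpace V] [BorelSpace V]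

section Density

variable {φ : V → ℝ}

/-- A temperate density gives a measure of temperate growth: if `(1+|ξ|²)^{-m} φ ∈ L¹` then
`(1+‖ξ‖)^{-2m} ∈ L¹(φ dξ)`. [folklore] -/
theorem hasTemperateGrowth_withDensity_ofReal (hφm : Measurable φ) (hφ0 : ∀ ξ, 0 ≤ φ ξ) {m : ℕ}
    (hφint : Integrable (fun ξ => (1 + ‖ξ‖ ^ 2) ^ (-(m : ℝ)) * φ ξ)) :
    ((volume : Measure V).withDensity fun ξ => ENNReal.ofReal (φ ξ)).HasTemperateGrowth := by
  refine ⟨⟨2 * m, ?_⟩⟩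
  rw [integrable_withDensity_ofReal_iff hφm hφ0]
  have hcont : Continuous fun ξ : V => (1 + ‖ξ‖) ^ (-((2 * m : ℕ) : ℝ)) :=
    (continuous_const.add continuous_norm).rpow_const fun ξ =>
      Or.inl (add_pos_of_pos_of_nonneg one_pos (norm_nonneg _)).ne'
  refine hφint.mono' (hφm.aestronglyMeasurable.smul hcont.aestronglyMeasurable)
    (Eventually.of_forall fun ξ => ?_)
  rw [smul_eq_mul, norm_mul, Real.norm_of_nonneg (hφ0 ξ), Real.norm_of_nonneg (by positivity),
    mul_comm]
  refine mul_le_mul_of_nonneg_right ?_ (hφ0 ξ)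
  have h1 : ((1 + ‖ξ‖) ^ 2) ^ (-(m : ℝ)) = (1 + ‖ξ‖) ^ (-((2 * m : ℕ) : ℝ)) := by
    rw [← Real.rpow_natCast, ← Real.rpow_mul (by positivity)]
    congr 1
    push_cast
    ring
  rw [← h1]
  exact Real.rpow_le_rpow_of_nonpos (by positivity) (by nlinarith [norm_nonneg ξ]) (by simp)

/-- A temperate density is locally integrable, so `φ dξ` is finite on compact sets. [folklore] -/
theorem isFiniteMeasureOnCompacts_withDensity_ofReal (hφm : Measurable φ) {m : ℕ}
    (hφint : Integrable (fun ξ => (1 + ‖ξ‖ ^ 2) ^ (-(m : ℝ)) * φ ξ)) :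
    IsFiniteMeasureOnCompacts ((volume : Measure V).withDensity fun ξ => ENNReal.ofReal (φ ξ)) := by
  refine ⟨fun K hK => ?_⟩
  rw [withDensity_apply _ hK.measurableSet]
  exact ((locallyIntegrable_of_integrable_weight hφm hφint).integrableOn_isCompact hK)
    |>.setLIntegral_lt_top

end Density

/-! ### Fourier transforms of real test functions -/

section RealTest

/-- Hermitian symmetry of the Fourier transform of a real test function:
`conj û(ξ) = û(-ξ)`. [folklore] -/
theorem conj_fourier_ofRealTest (w : 𝓢(V, ℝ)) (ξ : V) :
    conj (𝓕 (ofRealTest w) ξ) = 𝓕 (ofRealTest w) (-ξ) := by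
  rw [SchwartzMap.fourier_coe, Real.fourier_eq', Real.fourier_eq', ← integral_conj]
  congr 1 with v
  have h : (starRingEnd ℂ) (cexp (↑(-2 * Real.pi * ⟪v, ξ⟫_ℝ) * I)) =
      cexp (↑(-2 * Real.pi * ⟪v, -ξ⟫_ℝ) * I) := by
    rw [← Complex.exp_conj, map_mul, Complex.conj_ofReal, Complex.conj_I, inner_neg_right]
    congr 1
    push_cast
    ring
  simp only [smul_eq_mul, map_mul, h, ofRealTest_apply, Complex.conj_ofReal]

omit [FiniteDimensional ℝ V] [MeasurableSpace V] [BorelSpace V] in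
/-- Pointwise products of test functions with disjoint supports vanish. [folklore] -/
theorem mul_apply_eq_zero_of_disjoint_tsupport {A B : Set V} (hAB : Disjoint A B)
    {u w : 𝓢(V, ℝ)} (hu : tsupport u ⊆ A) (hw : tsupport w ⊆ B) (x : V) : u x * w x = 0 := by
  by_cases hx : x ∈ tsupport u
  · have hxB : x ∉ tsupport w := fun h => hAB.ne_of_mem (hu hx) (hw h) rfl
    rw [image_eq_zero_of_notMem_tsupport hxB, mul_zero]
  · rw [image_eq_zero_of_notMem_tsupport hx, zero_mul]

end RealTest

/-! ### The spectral space `L²(ν)` and the elements `û / φ` -/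

section SpectralSpace

variable {φ : V → ℝ} {ν : Measure V}

/-- Inner products of (Fourier transforms of) test functions in `L²(ν)`, `ν = φ dξ`:
`⟪f, g⟫_{L²(ν)} = ∫ φ conj(f) g dξ` (Rozanov Ch. 3 §1.2 (1.15)). [cite: Rozanov1982, Ch. 3 §1.2] -/
theorem inner_toLp_toLp_eq_integral
    (hν : ν = (volume : Measure V).withDensity fun ξ => ENNReal.ofReal (φ ξ))
    (hφm : Measurable φ) (hφ0 : ∀ ξ, 0 ≤ φ ξ) [ν.HasTemperateGrowth] (f g : 𝓢(V, ℂ)) :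
    ⟪f.toLp 2 ν, g.toLp 2 ν⟫_ℂ = ∫ ξ, (φ ξ : ℂ) * (conj (f ξ) * g ξ) := by
  rw [SchwartzMap.inner_toL2_toL2_eq f g ν]
  simp_rw [RCLike.inner_apply']
  subst hν
  exact integral_withDensity_ofReal_eq hφm hφ0 _

/-- For a temperate inverse density, `f̂ / φ ∈ L²(ν)` for every test function `f`
(`∫ φ |f̂/φ|² = ∫ |f̂|² / φ < ∞`; Rozanov Ch. 3 §1.3, the dual spectral density `1/φ`).
[cite: Rozanov1982, Ch. 3 §1.3 (1.25)] -/
theorem memLp_inv_mul_fourier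
    (hν : ν = (volume : Measure V).withDensity fun ξ => ENNReal.ofReal (φ ξ))
    (hφm : Measurable φ) (hφ0 : ∀ ξ, 0 ≤ φ ξ) {m' : ℕ}
    (hφinv : Integrable (fun ξ => (1 + ‖ξ‖ ^ 2) ^ (-(m' : ℝ)) * (φ ξ)⁻¹)) (f : 𝓢(V, ℂ)) :
    MemLp (fun ξ => ((φ ξ : ℂ))⁻¹ * 𝓕 f ξ) 2 ν := by
  subst hν
  have hmeas : Measurable fun ξ => ((φ ξ : ℂ))⁻¹ * 𝓕 f ξ :=
    (Complex.measurable_ofReal.comp hφm).inv.mul (𝓕 f).continuous.measurable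
  refine (memLp_two_iff_integrable_sq_norm hmeas.aestronglyMeasurable).2 ?_
  rw [integrable_withDensity_ofReal_iff hφm hφ0]
  obtain ⟨S, hS⟩ := (𝓕 f).exists_one_add_pow_mul_norm_le (2 * m')
  obtain ⟨C, hC⟩ := (𝓕 f).exists_one_add_pow_mul_norm_le 0
  have hS0 : 0 ≤ S := le_trans (by positivity) (hS 0)
  have hdecay : ∀ ξ, (1 + ‖ξ‖) ^ (2 * m') * ‖(((‖𝓕 f ξ‖ ^ 2 : ℝ)) : ℂ)‖ ≤ S * C := by
    intro ξ
    have hC' : ‖𝓕 f ξ‖ ≤ C := by simpa using hC ξ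
    rw [Complex.norm_real, Real.norm_of_nonneg (by positivity), pow_two, ← mul_assoc]
    exact mul_le_mul (hS ξ) hC' (norm_nonneg _) hS0
  have hint : Integrable (fun ξ => (φ ξ)⁻¹ * ‖𝓕 f ξ‖ ^ 2) := by
    have h := integrable_ofReal_mul_of_decay (ψ := fun ξ => (φ ξ)⁻¹) hφm.inv hφinv
      (F := fun ξ => (((‖𝓕 f ξ‖ ^ 2 : ℝ)) : ℂ))
      (Complex.continuous_ofReal.comp (((𝓕 f).continuous.norm).pow 2)) hdecay
    refine h.re.congr (Eventually.of_forall fun ξ => ?_)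
    simp only [← Complex.ofReal_mul, RCLike.re_to_complex, Complex.ofReal_re]
  refine hint.congr (Eventually.of_forall fun ξ => ?_)
  simp only [smul_eq_mul, norm_mul, norm_inv, Complex.norm_real, Real.norm_of_nonneg (hφ0 ξ)]
  rcases eq_or_ne (φ ξ) 0 with h | h
  · simp [h]
  · field_simp

/-- `⟪ĝ/φ, w⟫_{L²(ν)} = ∫ conj(ĝ) w dξ`: the density cancels (a.e. positivity of `φ`).
[cite: Rozanov1982, Ch. 3 §1.3 (1.23)] -/
theorem inner_invMulToLp_toLp
    (hν : ν = (volume : Measure V).withDensity fun ξ => ENNReal.ofReal (φ ξ))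
    (hφm : Measurable φ) (hφ0 : ∀ ξ, 0 ≤ φ ξ) (hφpos : ∀ᵐ ξ ∂(volume : Measure V), 0 < φ ξ)
    [ν.HasTemperateGrowth] {g : V → ℂ} (hq : MemLp (fun ξ => ((φ ξ : ℂ))⁻¹ * g ξ) 2 ν)
    (w : 𝓢(V, ℂ)) :
    ⟪hq.toLp _, w.toLp 2 ν⟫_ℂ = ∫ ξ, conj (g ξ) * w ξ := by
  subst hν
  rw [L2.inner_def]
  refine (integral_congr_ae (g := fun ξ => conj (((φ ξ : ℂ))⁻¹ * g ξ) * w ξ) ?_).trans ?_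
  · filter_upwards [hq.coeFn_toLp, w.coeFn_toLp 2
      ((volume : Measure V).withDensity fun ξ => ENNReal.ofReal (φ ξ))] with ξ h1 h2
    rw [h1, h2, RCLike.inner_apply']
  · rw [integral_withDensity_ofReal_eq hφm hφ0]
    refine integral_congr_ae ?_
    filter_upwards [hφpos] with ξ hξ
    have hne : (φ ξ : ℂ) ≠ 0 := Complex.ofReal_ne_zero.2 hξ.ne'
    simp only [map_mul, map_inv₀, Complex.conj_ofReal]
    field_simp

/-- `⟪ĝ₁/φ, ĝ₂/φ⟫_{L²(ν)} = ∫ conj(ĝ₁) ĝ₂ / φ dξ`: the dual elements have spectral density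
`1/φ`. [cite: Rozanov1982, Ch. 3 §1.3 (1.25)] -/
theorem inner_invMulToLp_invMulToLp
    (hν : ν = (volume : Measure V).withDensity fun ξ => ENNReal.ofReal (φ ξ))
    (hφm : Measurable φ) (hφ0 : ∀ ξ, 0 ≤ φ ξ) (hφpos : ∀ᵐ ξ ∂(volume : Measure V), 0 < φ ξ)
    {g₁ g₂ : V → ℂ} (hq₁ : MemLp (fun ξ => ((φ ξ : ℂ))⁻¹ * g₁ ξ) 2 ν)
    (hq₂ : MemLp (fun ξ => ((φ ξ : ℂ))⁻¹ * g₂ ξ) 2 ν) :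
    ⟪hq₁.toLp _, hq₂.toLp _⟫_ℂ = ∫ ξ, ((φ ξ : ℂ))⁻¹ * (conj (g₁ ξ) * g₂ ξ) := by
  subst hν
  rw [L2.inner_def]
  refine (integral_congr_ae
    (g := fun ξ => conj (((φ ξ : ℂ))⁻¹ * g₁ ξ) * (((φ ξ : ℂ))⁻¹ * g₂ ξ)) ?_).trans ?_
  · filter_upwards [hq₁.coeFn_toLp, hq₂.coeFn_toLp] with ξ h1 h2
    rw [h1, h2, RCLike.inner_apply']
  · rw [integral_withDensity_ofReal_eq hφm hφ0]
    refine integral_congr_ae ?_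
    filter_upwards [hφpos] with ξ hξ
    have hne : (φ ξ : ℂ) ≠ 0 := Complex.ofReal_ne_zero.2 hξ.ne'
    simp only [map_mul, map_inv₀, Complex.conj_ofReal]
    field_simp

/-- **Reality of the spectral isometry.** For real test functions `a`, `b` and an even density,
`⟪â, b̂⟫_{L²(ν)} = ∫ φ conj(â) b̂` is real (Hermitian symmetry `â(-ξ) = conj â(ξ)` and
`ξ ↦ -ξ` preserves Lebesgue measure). [cite: Rozanov1982, Ch. 3 §1.2 (1.16)] -/
theorem im_inner_fourier_toLp_eq_zero
    (hν : ν = (volume : Measure V).withDensity fun ξ => ENNReal.ofReal (φ ξ))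
    (hφm : Measurable φ) (hφ0 : ∀ ξ, 0 ≤ φ ξ) (hφev : ∀ ξ, φ (-ξ) = φ ξ) [ν.HasTemperateGrowth]
    (a b : 𝓢(V, ℝ)) :
    (⟪(𝓕 (ofRealTest a)).toLp 2 ν, (𝓕 (ofRealTest b)).toLp 2 ν⟫_ℂ).im = 0 := by
  rw [inner_toLp_toLp_eq_integral hν hφm hφ0, ← Complex.conj_eq_iff_im, ← integral_conj]
  conv_lhs => rw [← integral_neg_eq_self]
  congr 1 with ξ
  simp only [map_mul, Complex.conj_conj, Complex.conj_ofReal, hφev, ← conj_fourier_ofRealTest]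

/-- **Plancherel for the dual elements**: `⟪û/φ, ŵ⟫_{L²(ν)} = ∫ conj(û) ŵ = ∫ u w` for real
test functions (Rozanov Ch. 3 §1.3 (1.23): `⟪ξ*_u, ξ_w⟫ = (u, w)`). [cite: Rozanov1982, Ch. 3 §1.3 (1.23)] -/
theorem inner_invMulToLp_fourier_toLp
    (hν : ν = (volume : Measure V).withDensity fun ξ => ENNReal.ofReal (φ ξ))
    (hφm : Measurable φ) (hφ0 : ∀ ξ, 0 ≤ φ ξ) (hφpos : ∀ᵐ ξ ∂(volume : Measure V), 0 < φ ξ)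
    [ν.HasTemperateGrowth] {m' : ℕ}
    (hφinv : Integrable (fun ξ => (1 + ‖ξ‖ ^ 2) ^ (-(m' : ℝ)) * (φ ξ)⁻¹)) (u w : 𝓢(V, ℝ)) :
    ⟪(memLp_inv_mul_fourier hν hφm hφ0 hφinv (ofRealTest u)).toLp _,
        (𝓕 (ofRealTest w)).toLp 2 ν⟫_ℂ = ((∫ x, u x * w x : ℝ) : ℂ) := by
  rw [inner_invMulToLp_toLp hν hφm hφ0 hφpos]
  have hP := SchwartzMap.integral_inner_fourier_fourier (ofRealTest u) (ofRealTest w)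
  simp only [RCLike.inner_apply'] at hP
  rw [hP]
  simp only [ofRealTest_apply, Complex.conj_ofReal, ← Complex.ofReal_mul]
  exact integral_ofReal

/-- **Density of real transforms at the dual elements.** For every real test function `u`
there are real test functions `aₙ` with `âₙ → û/φ` in `L²(ν)`: complex Schwartz transforms are
dense in `L²(ν)` (`ν` has temperate growth and is finite on compacts), and by reality of all the
inner products involved the real parts of an approximating sequence still approximate
(`‖Re-part − û/φ‖ ≤ ‖θ̂ − û/φ‖`, Pythagoras). [cite: Rozanov1982, Ch. 3 §1.3 Lemma 2] -/
theorem exists_tendsto_fourier_toLp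
    (hν : ν = (volume : Measure V).withDensity fun ξ => ENNReal.ofReal (φ ξ))
    (hφm : Measurable φ) (hφ0 : ∀ ξ, 0 ≤ φ ξ) (hφpos : ∀ᵐ ξ ∂(volume : Measure V), 0 < φ ξ)
    (hφev : ∀ ξ, φ (-ξ) = φ ξ) [ν.HasTemperateGrowth] [IsFiniteMeasureOnCompacts ν] {m' : ℕ}
    (hφinv : Integrable (fun ξ => (1 + ‖ξ‖ ^ 2) ^ (-(m' : ℝ)) * (φ ξ)⁻¹)) (u : 𝓢(V, ℝ)) :
    ∃ a : ℕ → 𝓢(V, ℝ), Tendsto (fun n => (𝓕 (ofRealTest (a n))).toLp 2 ν) atTop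
      (𝓝 ((memLp_inv_mul_fourier hν hφm hφ0 hφinv (ofRealTest u)).toLp _)) := by
  set q := (memLp_inv_mul_fourier hν hφm hφ0 hφinv (ofRealTest u)).toLp _ with hq
  -- complex Schwartz transforms are dense in `L²(ν)`
  have hd : DenseRange (fun θ : 𝓢(V, ℂ) => (𝓕 θ).toLp 2 ν) := by
    have h1 : DenseRange (SchwartzMap.toLpCLM ℝ ℂ 2 ν) :=
      SchwartzMap.denseRange_toLpCLM ENNReal.ofNat_ne_top
    have h2 : Function.Surjective (fun θ : 𝓢(V, ℂ) => (𝓕 θ : 𝓢(V, ℂ))) :=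
      fun f => ⟨𝓕⁻ f, fourier_fourierInv_eq f⟩
    exact h1.comp h2.denseRange (SchwartzMap.toLpCLM ℝ ℂ 2 ν).continuous
  obtain ⟨θ, hθ⟩ : ∃ θ : ℕ → 𝓢(V, ℂ), Tendsto (fun n => (𝓕 (θ n)).toLp 2 ν) atTop (𝓝 q) := by
    have hmem : q ∈ closure (range fun θ : 𝓢(V, ℂ) => (𝓕 θ).toLp 2 ν) := by
      rw [hd.closure_range]; exact mem_univ q
    obtain ⟨x, hx, hlim⟩ := mem_closure_iff_seq_limit.1 hmem
    choose θ hθ using hx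
    exact ⟨θ, by simpa only [hθ] using hlim⟩
  refine ⟨fun n => reTest (θ n), ?_⟩
  -- Pythagoras: the real part approximates at least as well
  have key : ∀ n, ‖(𝓕 (ofRealTest (reTest (θ n)))).toLp 2 ν - q‖ ≤ ‖(𝓕 (θ n)).toLp 2 ν - q‖ := by
    intro n
    set A := (𝓕 (ofRealTest (reTest (θ n)))).toLp 2 ν - q with hA
    set B := (I : ℂ) • (𝓕 (ofRealTest (imTest (θ n)))).toLp 2 ν with hB
    have hθ' : ofRealTest (reTest (θ n)) + (I : ℂ) • ofRealTest (imTest (θ n)) = θ n := by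
      ext x
      simp only [add_apply, smul_apply, ofRealTest_apply, reTest_apply, imTest_apply,
        smul_eq_mul]
      rw [mul_comm, Complex.re_add_im]
    have hdec : (𝓕 (θ n)).toLp 2 ν - q = A + B := by
      set L := (SchwartzMap.toLpCLM ℂ ℂ 2 ν).comp (SchwartzMap.fourierTransformCLM ℂ (V := V) (E := ℂ))
        with hL
      have hLapp : ∀ g : 𝓢(V, ℂ), (𝓕 g).toLp 2 ν = L g := fun g => rfl
      have h1 : (𝓕 (θ n)).toLp 2 ν = (𝓕 (ofRealTest (reTest (θ n)))).toLp 2 ν +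
          (I : ℂ) • (𝓕 (ofRealTest (imTest (θ n)))).toLp 2 ν := by
        rw [hLapp, hLapp, hLapp, ← map_smul, ← map_add, hθ']
      rw [h1, hA, hB]
      abel
    have h1 : (⟪(𝓕 (ofRealTest (reTest (θ n)))).toLp 2 ν,
        (𝓕 (ofRealTest (imTest (θ n)))).toLp 2 ν⟫_ℂ).im = 0 :=
      im_inner_fourier_toLp_eq_zero hν hφm hφ0 hφev _ _
    have h2 : (⟪q, (𝓕 (ofRealTest (imTest (θ n)))).toLp 2 ν⟫_ℂ).im = 0 := by
      rw [hq, inner_invMulToLp_fourier_toLp hν hφm hφ0 hφpos hφinv, Complex.ofReal_im]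
    have horth : (⟪A, B⟫_ℂ).re = 0 := by
      rw [hB, inner_smul_right, hA, inner_sub_left, Complex.mul_re, Complex.sub_im, h1, h2]
      simp
    have hsq : ‖A + B‖ ^ 2 = ‖A‖ ^ 2 + ‖B‖ ^ 2 := by
      have := norm_add_sq (𝕜 := ℂ) A B
      simp only [RCLike.re_to_complex, horth, mul_zero, add_zero] at this
      exact this
    rw [hdec]
    refine le_of_pow_le_pow_left₀ two_ne_zero (norm_nonneg _) ?_
    rw [hsq]
    nlinarith [sq_nonneg ‖B‖]
  refine tendsto_iff_norm_sub_tendsto_zero.2 ?_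
  exact squeeze_zero (fun n => norm_nonneg _) key (tendsto_iff_norm_sub_tendsto_zero.1 hθ)

end SpectralSpace

/-! ### Dual elements in the Gaussian space (Rozanov Ch. 3 §1.3) -/

section Dual

/-- Limits transport the identity `⟪Yₙ, z⟫ = Re ⟪Tₙ, s⟫`. [folklore] -/
theorem inner_eq_re_inner_of_tendsto {H₁ : Type*} [NormedAddCommGroup H₁] [InnerProductSpace ℝ H₁]
    {H₂ : Type*} [NormedAddCommGroup H₂] [InnerProductSpace ℂ H₂]
    {Y : ℕ → H₁} {x z : H₁} {T : ℕ → H₂} {t s : H₂}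
    (hY : Tendsto Y atTop (𝓝 x)) (hT : Tendsto T atTop (𝓝 t))
    (h : ∀ n, ⟪Y n, z⟫_ℝ = (⟪T n, s⟫_ℂ).re) : ⟪x, z⟫_ℝ = (⟪t, s⟫_ℂ).re := by
  have h1 : Tendsto (fun n => ⟪Y n, z⟫_ℝ) atTop (𝓝 ⟪x, z⟫_ℝ) := hY.inner tendsto_const_nhds
  have h2 : Tendsto (fun n => (⟪T n, s⟫_ℂ).re) atTop (𝓝 (⟪t, s⟫_ℂ).re) :=
    (Complex.continuous_re.tendsto _).comp (hT.inner tendsto_const_nhds)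
  exact tendsto_nhds_unique h1 (h2.congr fun n => (h n).symm)

variable {φ : V → ℝ} {ν : Measure V} {μ : Measure (FieldConfig V)}

/-- **The spectral isometry** (Rozanov Ch. 3 §1.2 (1.13)–(1.17)): under the covariance
hypothesis `E[X_w X_w'] = Re ∫ φ ŵ conj(ŵ')`, inner products in the Gaussian space are real
parts of inner products of Fourier transforms in `L²(φ dξ)`. [cite: Rozanov1982, Ch. 3 §1.2] -/
theorem inner_toLp_eval_eq_re_inner
    (hX : IsGaussianProcess (fun (f : 𝓢(V, ℝ)) (ω : FieldConfig V) => ω f) μ)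
    (hν : ν = (volume : Measure V).withDensity fun ξ => ENNReal.ofReal (φ ξ))
    (hφm : Measurable φ) (hφ0 : ∀ ξ, 0 ≤ φ ξ) [ν.HasTemperateGrowth]
    (hcov : ∀ u v : 𝓢(V, ℝ), twoPoint μ u v =
      (∫ ξ, ((φ ξ : ℝ) : ℂ) * (𝓕 (fun x => ((u x : ℝ) : ℂ)) ξ *
        (starRingEnd ℂ) (𝓕 (fun x => ((v x : ℝ) : ℂ)) ξ))).re)
    (w w' : 𝓢(V, ℝ)) :
    ⟪(memLp_two_of_isGaussianProcess hX w).toLp (fun ω : FieldConfig V => ω w),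
        (memLp_two_of_isGaussianProcess hX w').toLp (fun ω : FieldConfig V => ω w')⟫_ℝ =
      (⟪(𝓕 (ofRealTest w)).toLp 2 ν, (𝓕 (ofRealTest w')).toLp 2 ν⟫_ℂ).re := by
  have hL : ⟪(memLp_two_of_isGaussianProcess hX w).toLp (fun ω : FieldConfig V => ω w),
      (memLp_two_of_isGaussianProcess hX w').toLp (fun ω : FieldConfig V => ω w')⟫_ℝ = twoPoint μ w w' := by
    rw [L2.inner_def, twoPoint]
    refine integral_congr_ae ?_
    filter_upwards [(memLp_two_of_isGaussianProcess hX w).coeFn_toLp,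
      (memLp_two_of_isGaussianProcess hX w').coeFn_toLp] with ω h1 h2
    rw [RCLike.inner_apply, conj_trivial, h1, h2, mul_comm]
  rw [hL, hcov w w', inner_toLp_toLp_eq_integral hν hφm hφ0]
  conv_rhs => rw [← Complex.conj_re, ← integral_conj]
  congr 1
  refine integral_congr_ae (Eventually.of_forall fun ξ => ?_)
  simp only [map_mul, Complex.conj_ofReal, Complex.conj_conj]
  rfl

/-- **Dual elements** (Rozanov Ch. 3 §1.3 (1.22)–(1.25)): for every real test function `u`
there is `x_u` in the Gaussian space `H(V)`, the `L²(μ)`-limit of field evaluations `X_{aₙ}` whose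
transforms `âₙ` tend to `û/φ` in `L²(φ dξ)`. [cite: Rozanov1982, Ch. 3 §1.3] -/
theorem exists_dual_element [IsProbabilityMeasure μ]
    (hX : IsGaussianProcess (fun (f : 𝓢(V, ℝ)) (ω : FieldConfig V) => ω f) μ)
    (hν : ν = (volume : Measure V).withDensity fun ξ => ENNReal.ofReal (φ ξ))
    (hφm : Measurable φ) (hφ0 : ∀ ξ, 0 ≤ φ ξ) (hφpos : ∀ᵐ ξ ∂(volume : Measure V), 0 < φ ξ)
    (hφev : ∀ ξ, φ (-ξ) = φ ξ) [ν.HasTemperateGrowth] [IsFiniteMeasureOnCompacts ν] {m' : ℕ}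
    (hφinv : Integrable (fun ξ => (1 + ‖ξ‖ ^ 2) ^ (-(m' : ℝ)) * (φ ξ)⁻¹))
    (hcovT : ∀ w w' : 𝓢(V, ℝ),
      ⟪(memLp_two_of_isGaussianProcess hX w).toLp (fun ω : FieldConfig V => ω w),
          (memLp_two_of_isGaussianProcess hX w').toLp (fun ω : FieldConfig V => ω w')⟫_ℝ =
        (⟪(𝓕 (ofRealTest w)).toLp 2 ν, (𝓕 (ofRealTest w')).toLp 2 ν⟫_ℂ).re)
    (u : 𝓢(V, ℝ)) :
    ∃ x : Lp ℝ 2 μ, x ∈ gaussianSpan hX univ ∧ ∃ a : ℕ → 𝓢(V, ℝ),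
      Tendsto (fun n => (memLp_two_of_isGaussianProcess hX (a n)).toLp (fun ω : FieldConfig V => ω (a n)))
        atTop (𝓝 x) ∧
      Tendsto (fun n => (𝓕 (ofRealTest (a n))).toLp 2 ν) atTop
        (𝓝 ((memLp_inv_mul_fourier hν hφm hφ0 hφinv (ofRealTest u)).toLp _)) := by
  obtain ⟨a, ha⟩ := exists_tendsto_fourier_toLp hν hφm hφ0 hφpos hφev hφinv u
  set Y : ℕ → Lp ℝ 2 μ := fun n =>
    (memLp_two_of_isGaussianProcess hX (a n)).toLp (fun ω : FieldConfig V => ω (a n)) with hY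
  set T : ℕ → Lp ℂ 2 ν := fun n => (𝓕 (ofRealTest (a n))).toLp 2 ν with hT
  have hdist : ∀ n k, dist (Y n) (Y k) = dist (T n) (T k) := by
    intro n k
    rw [dist_eq_norm, dist_eq_norm]
    have h1 : ‖Y n - Y k‖ ^ 2 = ‖T n - T k‖ ^ 2 := by
      rw [norm_sub_sq_real, norm_sub_sq (𝕜 := ℂ), ← real_inner_self_eq_norm_sq,
        ← real_inner_self_eq_norm_sq, ← inner_self_eq_norm_sq (𝕜 := ℂ) (T n),
        ← inner_self_eq_norm_sq (𝕜 := ℂ) (T k), hY, hcovT, hcovT, hcovT]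
      simp only [RCLike.re_to_complex, hT]
    exact (sq_eq_sq₀ (norm_nonneg _) (norm_nonneg _)).1 h1
  have hC : CauchySeq Y := by
    have hTc : CauchySeq T := ha.cauchySeq
    rw [Metric.cauchySeq_iff] at hTc ⊢
    intro ε hε
    obtain ⟨N, hN⟩ := hTc ε hε
    exact ⟨N, fun m hm n hn => by rw [hdist]; exact hN m hm n hn⟩
  obtain ⟨x, hx⟩ := cauchySeq_tendsto_of_complete hC
  refine ⟨x, ?_, a, hx, ha⟩
  exact (isClosed_gaussianSpan hX univ).mem_of_tendsto hx
    (Eventually.of_forall fun n => toLp_mem_gaussianSpan hX ⟨a n, mem_univ _⟩)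

/-- The dual element pairs with field evaluations as the `L²(dx)` pairing of test functions:
`⟪x_u, X_w⟫ = ∫ u w` (Rozanov Ch. 3 §1.3 (1.23), biorthogonality). [cite: Rozanov1982, Ch. 3 §1.3 (1.23)] -/
theorem inner_dual_toLp_eval [IsProbabilityMeasure μ]
    (hX : IsGaussianProcess (fun (f : 𝓢(V, ℝ)) (ω : FieldConfig V) => ω f) μ)
    (hν : ν = (volume : Measure V).withDensity fun ξ => ENNReal.ofReal (φ ξ))
    (hφm : Measurable φ) (hφ0 : ∀ ξ, 0 ≤ φ ξ) (hφpos : ∀ᵐ ξ ∂(volume : Measure V), 0 < φ ξ)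
    [ν.HasTemperateGrowth] {m' : ℕ}
    (hφinv : Integrable (fun ξ => (1 + ‖ξ‖ ^ 2) ^ (-(m' : ℝ)) * (φ ξ)⁻¹))
    (hcovT : ∀ w w' : 𝓢(V, ℝ),
      ⟪(memLp_two_of_isGaussianProcess hX w).toLp (fun ω : FieldConfig V => ω w),
          (memLp_two_of_isGaussianProcess hX w').toLp (fun ω : FieldConfig V => ω w')⟫_ℝ =
        (⟪(𝓕 (ofRealTest w)).toLp 2 ν, (𝓕 (ofRealTest w')).toLp 2 ν⟫_ℂ).re)
    {u : 𝓢(V, ℝ)} {x : Lp ℝ 2 μ} {a : ℕ → 𝓢(V, ℝ)}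
    (hx : Tendsto (fun n => (memLp_two_of_isGaussianProcess hX (a n)).toLp (fun ω : FieldConfig V => ω (a n)))
      atTop (𝓝 x))
    (ha : Tendsto (fun n => (𝓕 (ofRealTest (a n))).toLp 2 ν) atTop
      (𝓝 ((memLp_inv_mul_fourier hν hφm hφ0 hφinv (ofRealTest u)).toLp _)))
    (w : 𝓢(V, ℝ)) :
    ⟪x, (memLp_two_of_isGaussianProcess hX w).toLp (fun ω : FieldConfig V => ω w)⟫_ℝ = ∫ y, u y * w y := by
  rw [inner_eq_re_inner_of_tendsto hx ha fun n => hcovT (a n) w,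
    inner_invMulToLp_fourier_toLp hν hφm hφ0 hφpos hφinv u w, Complex.ofReal_re]

/-- Inner products of dual elements: `⟪x_u, x_v⟫ = Re ∫ conj(û) v̂ / φ` — the dual field has
spectral density `1/φ` (Rozanov Ch. 3 §1.3 (1.25)). [cite: Rozanov1982, Ch. 3 §1.3 (1.25)] -/
theorem inner_dual_dual [IsProbabilityMeasure μ]
    (hX : IsGaussianProcess (fun (f : 𝓢(V, ℝ)) (ω : FieldConfig V) => ω f) μ)
    (hν : ν = (volume : Measure V).withDensity fun ξ => ENNReal.ofReal (φ ξ))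
    (hφm : Measurable φ) (hφ0 : ∀ ξ, 0 ≤ φ ξ) (hφpos : ∀ᵐ ξ ∂(volume : Measure V), 0 < φ ξ)
    [ν.HasTemperateGrowth] {m' : ℕ}
    (hφinv : Integrable (fun ξ => (1 + ‖ξ‖ ^ 2) ^ (-(m' : ℝ)) * (φ ξ)⁻¹))
    (hcovT : ∀ w w' : 𝓢(V, ℝ),
      ⟪(memLp_two_of_isGaussianProcess hX w).toLp (fun ω : FieldConfig V => ω w),
          (memLp_two_of_isGaussianProcess hX w').toLp (fun ω : FieldConfig V => ω w')⟫_ℝ =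
        (⟪(𝓕 (ofRealTest w)).toLp 2 ν, (𝓕 (ofRealTest w')).toLp 2 ν⟫_ℂ).re)
    {u v : 𝓢(V, ℝ)} {x y : Lp ℝ 2 μ} {a b : ℕ → 𝓢(V, ℝ)}
    (hx : Tendsto (fun n => (memLp_two_of_isGaussianProcess hX (a n)).toLp (fun ω : FieldConfig V => ω (a n)))
      atTop (𝓝 x))
    (ha : Tendsto (fun n => (𝓕 (ofRealTest (a n))).toLp 2 ν) atTop
      (𝓝 ((memLp_inv_mul_fourier hν hφm hφ0 hφinv (ofRealTest u)).toLp _)))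
    (hy : Tendsto (fun n => (memLp_two_of_isGaussianProcess hX (b n)).toLp (fun ω : FieldConfig V => ω (b n)))
      atTop (𝓝 y))
    (hb : Tendsto (fun n => (𝓕 (ofRealTest (b n))).toLp 2 ν) atTop
      (𝓝 ((memLp_inv_mul_fourier hν hφm hφ0 hφinv (ofRealTest v)).toLp _))) :
    ⟪x, y⟫_ℝ = (∫ ξ, ((φ ξ : ℂ))⁻¹ *
      (conj (𝓕 (ofRealTest u) ξ) * 𝓕 (ofRealTest v) ξ)).re := by
  have h1 : ∀ n, ⟪(memLp_two_of_isGaussianProcess hX (a n)).toLp (fun ω : FieldConfig V => ω (a n)), y⟫_ℝ =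
      (⟪(𝓕 (ofRealTest (a n))).toLp 2 ν,
        (memLp_inv_mul_fourier hν hφm hφ0 hφinv (ofRealTest v)).toLp _⟫_ℂ).re := by
    intro n
    have h := inner_eq_re_inner_of_tendsto hy hb fun k => hcovT (b k) (a n)
    rw [real_inner_comm, h, ← inner_conj_symm, Complex.conj_re]
  rw [inner_eq_re_inner_of_tendsto hx ha h1, inner_invMulToLp_invMulToLp hν hφm hφ0 hφpos]

/-- A dual element `x_u` is orthogonal to the Gaussian subspace `H(B)` of any region `B`
disjoint from a set carrying the support of `u` (`⟪x_u, X_w⟫ = ∫ u w = 0`).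
[cite: Rozanov1982, Ch. 3 §1.3 (1.26)] -/
theorem dual_mem_orthogonal_gaussianSpan
    (hX : IsGaussianProcess (fun (f : 𝓢(V, ℝ)) (ω : FieldConfig V) => ω f) μ)
    {u : 𝓢(V, ℝ)} {x : Lp ℝ 2 μ}
    (hx : ∀ w : 𝓢(V, ℝ),
      ⟪x, (memLp_two_of_isGaussianProcess hX w).toLp (fun ω : FieldConfig V => ω w)⟫_ℝ = ∫ y, u y * w y)
    {A B : Set V} (hAB : Disjoint A B) (hu : tsupport u ⊆ A) :
    x ∈ (gaussianSpan hX {f | tsupport f ⊆ B})ᗮ := by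
  have hle : gaussianSpan hX {f | tsupport f ⊆ B} ≤ (ℝ ∙ x)ᗮ := by
    refine gaussianSpan_le hX (Submodule.isClosed_orthogonal _) fun w => ?_
    rw [Submodule.mem_orthogonal_singleton_iff_inner_right, hx]
    simp [mul_apply_eq_zero_of_disjoint_tsupport hAB hu w.2]
  exact Submodule.orthogonal_le hle
    (Submodule.le_orthogonal_orthogonal _ (Submodule.mem_span_singleton_self x))

end Dual

/-! ### The key identity of the necessity proof (Rozanov Ch. 3 §2.3) -/

section Key

omit [InnerProductSpace ℝ V] [FiniteDimensional ℝ V] [MeasurableSpace V] [BorelSpace V] in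
/-- `B̄(0, r - ε)` does not meet the collar `(∂B(0, r))^ε`. [folklore] -/
theorem disjoint_closedBall_thickening_sphere {r ε : ℝ} :
    Disjoint (closedBall (0 : V) (r - ε)) (thickening ε (sphere (0 : V) r)) := by
  refine disjoint_left.2 fun x hx hx' => ?_
  rw [mem_closedBall, dist_zero_right] at hx
  obtain ⟨z, hz, hxz⟩ := mem_thickening_iff.1 hx'
  rw [mem_sphere, dist_zero_right] at hz
  have := norm_sub_norm_le z x
  rw [← dist_eq_norm, dist_comm] at this
  linarith

omit [InnerProductSpace ℝ V] [FiniteDimensional ℝ V] [MeasurableSpace V] [BorelSpace V] in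
/-- The exterior of `B(0, r + ε)` does not meet the collar `(∂B(0, r))^ε`. [folklore] -/
theorem disjoint_compl_ball_thickening_sphere {r ε : ℝ} :
    Disjoint (ball (0 : V) (r + ε))ᶜ (thickening ε (sphere (0 : V) r)) := by
  refine disjoint_left.2 fun x hx hx' => ?_
  rw [mem_compl_iff, mem_ball, dist_zero_right, not_lt] at hx
  obtain ⟨z, hz, hxz⟩ := mem_thickening_iff.1 hx'
  rw [mem_sphere, dist_zero_right] at hz
  have := norm_le_norm_add_norm_sub' x z
  rw [← dist_eq_norm] at this
  linarith

/-- **Key identity** (Rozanov Ch. 3 §2.3, necessity; combination of the duality §1.3 with the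
splitting (3.10) of Ch. 2 §3.3).  If the collar `(∂B(0,r))^ε` splits `B(0,r)` from `B̄(0,r)ᶜ`
for the centred Gaussian field with spectral density `φ`, then for real test functions `u`
supported in `B̄(0, r-ε)` and `v` supported off `B(0, r+ε)` the dual elements are orthogonal:
`Re ∫ conj(û(ξ)) v̂(ξ) / φ(ξ) dξ = ⟪x_u, x_v⟫ = 0`. [cite: Rozanov1982, Ch. 3 §2.3 Theorem] -/
theorem re_integral_inv_mul_conj_fourier_mul_fourier_eq_zero {φ : V → ℝ} {ν : Measure V}
    {μ : Measure (FieldConfig V)} [IsProbabilityMeasure μ] (hμ : IsGaussianField μ)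
    (hν : ν = (volume : Measure V).withDensity fun ξ => ENNReal.ofReal (φ ξ))
    (hφm : Measurable φ) (hφ0 : ∀ ξ, 0 ≤ φ ξ) (hφpos : ∀ᵐ ξ ∂(volume : Measure V), 0 < φ ξ)
    (hφev : ∀ ξ, φ (-ξ) = φ ξ) [ν.HasTemperateGrowth] [IsFiniteMeasureOnCompacts ν] {m' : ℕ}
    (hφinv : Integrable (fun ξ => (1 + ‖ξ‖ ^ 2) ^ (-(m' : ℝ)) * (φ ξ)⁻¹))
    (hcovT : ∀ w w' : 𝓢(V, ℝ),
      ⟪(memLp_two_of_isGaussianProcess hμ.isGaussianProcess_eval w).toLp (fun ω : FieldConfig V => ω w),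
          (memLp_two_of_isGaussianProcess hμ.isGaussianProcess_eval w').toLp (fun ω : FieldConfig V => ω w')⟫_ℝ =
        (⟪(𝓕 (ofRealTest w)).toLp 2 ν, (𝓕 (ofRealTest w')).toLp 2 ν⟫_ℂ).re)
    {r ε : ℝ} (hε : 0 < ε) (hεr : ε < r)
    (hM : CondIndepCondExp (fieldSigma (thickening ε (sphere (0 : V) r)))
      (fieldSigma (ball (0 : V) r)) (fieldSigma (closedBall (0 : V) r)ᶜ) μ)
    {u v : 𝓢(V, ℝ)} (hu : tsupport u ⊆ closedBall 0 (r - ε))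
    (hv : tsupport v ⊆ (ball 0 (r + ε))ᶜ) :
    (∫ ξ, ((φ ξ : ℂ))⁻¹ * (conj (𝓕 (ofRealTest u) ξ) * 𝓕 (ofRealTest v) ξ)).re = 0 := by
  obtain ⟨x, hxmem, a, hxa, ha⟩ :=
    exists_dual_element hμ.isGaussianProcess_eval hν hφm hφ0 hφpos hφev hφinv hcovT u
  obtain ⟨y, -, b, hyb, hb⟩ :=
    exists_dual_element hμ.isGaussianProcess_eval hν hφm hφ0 hφpos hφev hφinv hcovT v
  have hxw := inner_dual_toLp_eval hμ.isGaussianProcess_eval hν hφm hφ0 hφpos hφinv hcovT hxa ha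
  have hyw := inner_dual_toLp_eval hμ.isGaussianProcess_eval hν hφm hφ0 hφpos hφinv hcovT hyb hb
  rw [← inner_dual_dual hμ.isGaussianProcess_eval hν hφm hφ0 hφpos hφinv hcovT hxa ha hyb hb]
  refine inner_eq_zero_of_collar_condIndepCondExp hμ hε hεr hM hxmem ?_ ?_ ?_ ?_
  · exact dual_mem_orthogonal_gaussianSpan _ hxw disjoint_closedBall_thickening_sphere hu
  · exact dual_mem_orthogonal_gaussianSpan _ hxw
      (disjoint_compl_right_iff_subset.2 (closedBall_subset_closedBall (by linarith))) hu
  · exact dual_mem_orthogonal_gaussianSpan _ hyw disjoint_compl_ball_thickening_sphere hv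
  · exact dual_mem_orthogonal_gaussianSpan _ hyw
      (disjoint_compl_left_iff_subset.2 (ball_subset_ball (by linarith))) hv

end Key

end Literature.MathematicalPhysics.QuantumLattice
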